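import Literature.AlgebraicGeometry.Frobenioids.UnitTrivializationFunctor
import Literature.AlgebraicGeometry.Frobenioids.IsometricPreSteps
import HarnessLib

/-!
# Frobenioids I, Proposition 3.3 (iv): pull-back morphisms, pre-steps and Frobenius-type arrows of
# `C^un-tr` (towards "`C^un-tr` is a Frobenioid", Def. 1.3 (i)(c), (ii), (iv), (v)(a))

Mochizuki, *The geometry of Frobenioids I: the general theory*, Kyushu J. Math. **62** (2008)
293–400, Prop. 3.3 (iv) p. 60 and its proof p. 61 ("In light of assertions (ii), (iii), assertion
(iv) is immediate from the definitions.") [cite: MochizukiFrdI2008, Prop. 3.3 (iv) p.60]. Proof-only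
sequel of `UnitTrivializationFunctor.lean` (construction row «`C^un-tr` is a Frobenioid +
`(C^un-tr)^birat`», seat abc-iut-L1-d5; input of Prop. 4.8 (iii), seat abc-iut-L6-t20). For a Frobenioid
`F : C → F_Φ`, `S = ofFunctor Φ F`, `Q = S.toUntr : C^istr → C^un-tr`, `U = untrFunctor hF`:

* `map_eq_of_comp_linear_eq` — cancellation in `F_Φ` of a linear arrow on the right when the bases of
  the two candidates agree (divisors cancel in the integral monoid `Φ`);
* `isPullbackMorphism_toUntr_of` — the pull-back clause of the dictionary, direction `C^istr ⇒ C^un-tr`: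
  if `a` is a pull-back morphism of `C` then `Q a` is one of `C^un-tr` (existence from `C`, uniqueness
  from Prop. 3.3 (ii) and `deg_Fr(a) = 1`);
* `mono_of_isPreStep_untr` — Def. 1.3 (v)(a) for `C^un-tr`: pre-steps are monomorphisms;
* `exists_iso_of_isFrobeniusType_untr` — Def. 1.3 (ii), uniqueness, for `C^un-tr`;
* `exists_iso_comp_toUntr_of_isPullbackMorphism` — a pull-back morphism `α` of `C^un-tr` is, up to an
  isomorphism of its source, the class of a pull-back morphism of `C` (factor a representative by
  Def. 1.3 (iv)(a) in `C` and compare the two pull-backs); hence `isLBInvertible_isLinear_of_isPullback_untr`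
  — Def. 1.3 (iv)(b) for `C^un-tr`;
* `factorisation_unique_untr` — Def. 1.3 (iv)(a), uniqueness, for `C^un-tr` (from (ii)-uniqueness,
  total epimorphicity and the universal property of pull-back morphisms).
No statement of the paper is strengthened; nothing here bears on [IUTchIII] Cor. 3.12.
-/

namespace Literature.AlgebraicGeometry.Frobenioids

open CategoryTheory Opposite

universe w v v' u u'

namespace PreFrobenioid

variable {D : Type u} [Category.{v} D] {Φ : Dᵒᵖ ⥤ CommMonCat.{w}} {C : Type u'}
  [Category.{v'} C] {F : C ⥤ ElemFrobenioid Φ}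

open PreFrobenioidData (ofFunctor)

/-! ### Cancellation in `F_Φ` -/

/-- Right cancellation of a LINEAR arrow `b` in `F_Φ` between arrows of `C^istr` with the same base:
if `a₁ ≫ b` and `a₂ ≫ b` have the same image in `F_Φ` and `Base(a₁) = Base(a₂)`, then `a₁`, `a₂` have
the same image (`deg_Fr` cancels in `N_{≥1}`, `Div` cancels in the integral monoid `Φ(Base Z)`).
[cite: MochizukiFrdI2008, Rem. 1.1.1 p.21] -/
theorem map_eq_of_comp_linear_eq (hF : IsFrobenioid F) {Z X Y : (ofFunctor Φ F).Istr}
    (a₁ a₂ : Z ⟶ X) (b : X ⟶ Y) (hlin : IsLinear F b.hom)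
    (hbase : Base F a₁.hom = Base F a₂.hom) (e : F.map (a₁ ≫ b).hom = F.map (a₂ ≫ b).hom) :
    F.map a₁.hom = F.map a₂.hom := by
  have hP := hF.isPreFrobenioid
  haveI : IsCancelMul (Φ.obj (op (baseObj F Z.obj))) :=
    isIntegral_iff_isCancelMul.mp (hP.isDivisorial _).isPreDivisorial.isIntegral
  have hdeg : degFr F a₁.hom = degFr F a₂.hom := by
    have h := congrArg ElemFrobenioid.Hom.degFr e
    change degFr F (a₁.hom ≫ b.hom) = degFr F (a₂.hom ≫ b.hom) at h
    rw [degFr_comp, degFr_comp] at h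
    exact mul_right_cancel h
  have hdiv : Div F a₁.hom = Div F a₂.hom := by
    have h := congrArg ElemFrobenioid.Hom.div e
    change Div F (a₁.hom ≫ b.hom) = Div F (a₂.hom ≫ b.hom) at h
    have h1 : (degFr F b.hom : ℕ) = 1 := by rw [hlin, PNat.one_coe]
    rw [div_comp, div_comp, hbase, h1, pow_one, pow_one] at h
    exact mul_left_cancel h
  exact ElemFrobenioid.Hom.ext hbase hdiv hdeg

/-! ### Pull-back morphisms of `C` give pull-back morphisms of `C^un-tr` -/

/-- **Prop. 3.3 (iv), dictionary, "pull-back morphism"** (direction `C^istr ⇒ C^un-tr`): the class of a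
pull-back morphism of `C` (between isotropic objects) is a pull-back morphism of `C^un-tr` for
`C^un-tr → F_Φ` — existence of lifts from the universal property in `C`, uniqueness because two lifts
with the same base and the same composite with `[a]` have the same image in `F_Φ` (`a` is linear,
Def. 1.3 (iv)(b)), i.e. coincide in `C^un-tr` (Prop. 3.3 (ii)). [cite: MochizukiFrdI2008, Prop. 3.3 (iv) p.60] -/
theorem isPullbackMorphism_toUntr_of (hF : IsFrobenioid F) {A' A : (ofFunctor Φ F).Istr} (a : A' ⟶ A)
    (ha : IsPullbackMorphism F a.hom) :
    IsPullbackMorphism (untrFunctor hF) ((ofFunctor Φ F).toUntr.map a) := by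
  have hlin : IsLinear F a.hom := (hF.iv_b a.hom ha).2
  intro X
  constructor
  · intro ψ₁ ψ₂ h
    obtain ⟨p₁, rfl⟩ := (ofFunctor Φ F).toUntr.map_surjective (X := X.as) (Y := A') ψ₁
    obtain ⟨p₂, rfl⟩ := (ofFunctor Φ F).toUntr.map_surjective (X := X.as) (Y := A') ψ₂
    have h1 := congrArg (fun q : PullbackHomData (untrFunctor hF) ((ofFunctor Φ F).toUntr.map a) X =>
      q.1.1) h
    have h2 := congrArg (fun q : PullbackHomData (untrFunctor hF) ((ofFunctor Φ F).toUntr.map a) X =>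
      q.1.2) h
    change (ofFunctor Φ F).toUntr.map p₁ ≫ (ofFunctor Φ F).toUntr.map a =
      (ofFunctor Φ F).toUntr.map p₂ ≫ (ofFunctor Φ F).toUntr.map a at h1
    change Base F p₁.hom = Base F p₂.hom at h2
    rw [← Functor.map_comp, ← Functor.map_comp, toUntr_map_eq_iff hF] at h1
    exact (toUntr_map_eq_iff hF p₁ p₂).mpr (map_eq_of_comp_linear_eq hF p₁ p₂ a hlin h2 h1)
  · rintro ⟨⟨χ, β⟩, hχ⟩
    obtain ⟨c, rfl⟩ := (ofFunctor Φ F).toUntr.map_surjective (X := X.as) (Y := A) χ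
    obtain ⟨ψ₀, hψ₀⟩ := (ha X.as.obj).2 ⟨(c.hom, β), hχ⟩
    have hψ₁ : ψ₀ ≫ a.hom = c.hom := congrArg (fun q : PullbackHomData F a.hom X.as.obj => q.1.1) hψ₀
    have hψ₂ : Base F ψ₀ = β := congrArg (fun q : PullbackHomData F a.hom X.as.obj => q.1.2) hψ₀
    refine ⟨(ofFunctor Φ F).toUntr.map (ObjectProperty.homMk ψ₀), Subtype.ext (Prod.ext ?_ hψ₂)⟩
    change (ofFunctor Φ F).toUntr.map (ObjectProperty.homMk ψ₀) ≫ (ofFunctor Φ F).toUntr.map a =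
      (ofFunctor Φ F).toUntr.map c
    rw [← Functor.map_comp]
    exact congrArg _ (ObjectProperty.hom_ext _ hψ₁)

/-! ### Def. 1.3 (v)(a) and (ii) for `C^un-tr` -/

/-- **Def. 1.3 (v)(a) for `C^un-tr`**: pre-steps of `C^un-tr` are monomorphisms (cancel the pre-step in
`F_Φ`: its base is an isomorphism of the totally epimorphic `D`, and it is linear).
[cite: MochizukiFrdI2008, Def. 1.3 (v) p.24] -/
theorem mono_of_isPreStep_untr (hF : IsFrobenioid F) {X Y : (ofFunctor Φ F).Untr} (g : X ⟶ Y)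
    (hg : IsPreStep (untrFunctor hF) g) : Mono g := by
  refine ⟨fun {Z} h₁ h₂ e => ?_⟩
  obtain ⟨b, rfl⟩ := (ofFunctor Φ F).toUntr.map_surjective (X := X.as) (Y := Y.as) g
  obtain ⟨a₁, rfl⟩ := (ofFunctor Φ F).toUntr.map_surjective (X := Z.as) (Y := X.as) h₁
  obtain ⟨a₂, rfl⟩ := (ofFunctor Φ F).toUntr.map_surjective (X := Z.as) (Y := X.as) h₂
  change (ofFunctor Φ F).toUntr.map a₁ ≫ (ofFunctor Φ F).toUntr.map b =
    (ofFunctor Φ F).toUntr.map a₂ ≫ (ofFunctor Φ F).toUntr.map b at e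
  rw [← Functor.map_comp, ← Functor.map_comp, toUntr_map_eq_iff hF] at e
  refine (toUntr_map_eq_iff hF a₁ a₂).mpr (map_eq_of_comp_linear_eq hF a₁ a₂ b hg.1 ?_ e)
  -- bases: `Base a₁ ≫ Base b = Base a₂ ≫ Base b` with `Base b` an isomorphism
  haveI : IsIso (Base F b.hom) := hg.2
  have h := congrArg ElemFrobenioid.Hom.base e
  change Base F (a₁.hom ≫ b.hom) = Base F (a₂.hom ≫ b.hom) at h
  rw [base_comp, base_comp] at h
  exact (cancel_mono (Base F b.hom)).mp h

/-- **Def. 1.3 (ii), uniqueness, for `C^un-tr`**: two arrows of Frobenius type of the same Frobenius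
degree out of the same object of `C^un-tr` differ by an isomorphism of their codomains (lift to `C`,
where representatives are of Frobenius type, and push the comparison isomorphism of `C` down).
[cite: MochizukiFrdI2008, Def. 1.3 (ii) p.24] -/
theorem exists_iso_of_isFrobeniusType_untr (hF : IsFrobenioid F) {A B B' : (ofFunctor Φ F).Untr}
    (φ : A ⟶ B) (ψ : A ⟶ B') (hφ : IsFrobeniusType (untrFunctor hF) φ)
    (hψ : IsFrobeniusType (untrFunctor hF) ψ) (hdeg : degFr (untrFunctor hF) φ = degFr (untrFunctor hF) ψ) :
    ∃ β : B ≅ B', φ ≫ β.hom = ψ := by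
  obtain ⟨f, rfl⟩ := (ofFunctor Φ F).toUntr.map_surjective (X := A.as) (Y := B.as) φ
  obtain ⟨g, rfl⟩ := (ofFunctor Φ F).toUntr.map_surjective (X := A.as) (Y := B'.as) ψ
  obtain ⟨β₀, hβ₀⟩ := hF.ii_unique f.hom g.hom ((isFrobeniusType_toUntr_iff hF f).mp hφ)
    ((isFrobeniusType_toUntr_iff hF g).mp hψ) hdeg
  refine ⟨(ofFunctor Φ F).toUntr.mapIso ((ofFunctor Φ F).isotropicObjects.isoMk β₀), ?_⟩
  change (ofFunctor Φ F).toUntr.map f ≫ (ofFunctor Φ F).toUntr.map (ObjectProperty.homMk β₀.hom) =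
    (ofFunctor Φ F).toUntr.map g
  rw [← Functor.map_comp]
  exact congrArg _ (ObjectProperty.hom_ext _ hβ₀)

/-! ### Pull-back morphisms of `C^un-tr` come from pull-back morphisms of `C` -/

/-- A pull-back morphism `α : Y → B` of `C^un-tr` is, up to an isomorphism of its source, the class of
a pull-back morphism of `C`: writing a representative as (Frobenius type) ≫ (pre-step) ≫ (pull-back `p`)
in `C` (Def. 1.3 (iv)(a)), the classes `α` and `[p]` are pull-back morphisms of `C^un-tr` over base
arrows differing by the isomorphism `Base` of the first two factors, so the universal properties give
mutually inverse comparison arrows. [cite: MochizukiFrdI2008, Prop. 3.3 (iv) p.60] -/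
theorem exists_iso_comp_toUntr_of_isPullbackMorphism (hF : IsFrobenioid F) {Y B : (ofFunctor Φ F).Untr}
    (α : Y ⟶ B) (hα : IsPullbackMorphism (untrFunctor hF) α) :
    ∃ (P : (ofFunctor Φ F).Istr) (p : P ⟶ B.as) (e : Y ≅ (ofFunctor Φ F).toUntr.obj P),
      IsPullbackMorphism F p.hom ∧ α = e.hom ≫ (ofFunctor Φ F).toUntr.map p := by
  obtain ⟨a, rfl⟩ := (ofFunctor Φ F).toUntr.map_surjective (X := Y.as) (Y := B.as) α
  obtain ⟨X₀, P₀, c, b, p, hfac, hc, hb, hp⟩ := hF.iv_a_exists a.hom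
  have hY : IsIsotropic F Y.as.obj := (PreFrobenioidData.ofFunctor_isIsotropic F _).mp Y.as.property
  have hP₀ : (ofFunctor Φ F).IsIsotropic P₀ :=
    (PreFrobenioidData.ofFunctor_isIsotropic F P₀).mpr (hF.vii_b (c ≫ b) hY)
  let P : (ofFunctor Φ F).Istr := ⟨P₀, hP₀⟩
  let cb : Y.as ⟶ P := ObjectProperty.homMk (c ≫ b)
  let p' : P ⟶ B.as := ObjectProperty.homMk p
  have hfac' : cb ≫ p' = a := ObjectProperty.hom_ext _ (by
    change (c ≫ b) ≫ p = a.hom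
    rw [Category.assoc, hfac])
  have hQp : IsPullbackMorphism (untrFunctor hF) ((ofFunctor Φ F).toUntr.map p') :=
    isPullbackMorphism_toUntr_of hF p' hp
  haveI : IsIso (Base F c) := hc.2
  haveI : IsIso (Base F b) := hb.2
  haveI : IsIso (Base F (c ≫ b)) := by rw [base_comp F c b]; infer_instance
  -- the base isomorphism `Base(c ≫ b) : Base Y → Base P`
  let eb : baseObj F Y.as.obj ≅ baseObj F P₀ := asIso (Base F (c ≫ b))
  have heb : eb.hom = Base F (c ≫ b) := rfl
  -- the comparison arrow `ψ : [P] → Y` from the universal property of `[a]`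
  have hdata : Base (untrFunctor hF) ((ofFunctor Φ F).toUntr.map p') =
      eb.inv ≫ Base (untrFunctor hF) ((ofFunctor Φ F).toUntr.map a) := by
    change Base F p = eb.inv ≫ Base F a.hom
    rw [← hfac, show c ≫ b ≫ p = (c ≫ b) ≫ p from (Category.assoc c b p).symm, base_comp F (c ≫ b) p,
      ← heb, eb.inv_hom_id_assoc]
  obtain ⟨ψ, hψ⟩ := (hα ((ofFunctor Φ F).toUntr.obj P)).2
    ⟨((ofFunctor Φ F).toUntr.map p', eb.inv), hdata⟩
  have hψ₁ : ψ ≫ (ofFunctor Φ F).toUntr.map a = (ofFunctor Φ F).toUntr.map p' :=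
    congrArg (fun q : PullbackHomData (untrFunctor hF) ((ofFunctor Φ F).toUntr.map a)
      ((ofFunctor Φ F).toUntr.obj P) => q.1.1) hψ
  have hψ₂ : Base (untrFunctor hF) ψ = eb.inv :=
    congrArg (fun q : PullbackHomData (untrFunctor hF) ((ofFunctor Φ F).toUntr.map a)
      ((ofFunctor Φ F).toUntr.obj P) => q.1.2) hψ
  have hQa : (ofFunctor Φ F).toUntr.map cb ≫ (ofFunctor Φ F).toUntr.map p' =
      (ofFunctor Φ F).toUntr.map a := by rw [← Functor.map_comp, hfac']
  -- `ψ ≫ [cb] = 𝟙`: both lift `([p'], 𝟙)` along the pull-back `[p']`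
  have h₁ : ψ ≫ (ofFunctor Φ F).toUntr.map cb = 𝟙 _ := by
    apply (hQp ((ofFunctor Φ F).toUntr.obj P)).1
    apply Subtype.ext
    apply Prod.ext
    · change (ψ ≫ (ofFunctor Φ F).toUntr.map cb) ≫ (ofFunctor Φ F).toUntr.map p' =
        𝟙 _ ≫ (ofFunctor Φ F).toUntr.map p'
      rw [Category.id_comp]
      calc (ψ ≫ (ofFunctor Φ F).toUntr.map cb) ≫ (ofFunctor Φ F).toUntr.map p'
          = ψ ≫ ((ofFunctor Φ F).toUntr.map cb ≫ (ofFunctor Φ F).toUntr.map p') := Category.assoc _ _ _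
        _ = ψ ≫ (ofFunctor Φ F).toUntr.map a := congrArg (fun t => ψ ≫ t) hQa
        _ = (ofFunctor Φ F).toUntr.map p' := hψ₁
    · change Base (untrFunctor hF) (ψ ≫ (ofFunctor Φ F).toUntr.map cb) = Base (untrFunctor hF) (𝟙 _)
      rw [base_comp, hψ₂, base_id]
      exact eb.inv_hom_id
  -- `[cb] ≫ ψ = 𝟙`: both lift `([a], 𝟙)` along the pull-back `[a]`
  have h₂ : (ofFunctor Φ F).toUntr.map cb ≫ ψ = 𝟙 _ := by
    apply (hα Y).1
    apply Subtype.ext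
    apply Prod.ext
    · change ((ofFunctor Φ F).toUntr.map cb ≫ ψ) ≫ (ofFunctor Φ F).toUntr.map a =
        𝟙 _ ≫ (ofFunctor Φ F).toUntr.map a
      rw [Category.id_comp]
      calc ((ofFunctor Φ F).toUntr.map cb ≫ ψ) ≫ (ofFunctor Φ F).toUntr.map a
          = (ofFunctor Φ F).toUntr.map cb ≫ (ψ ≫ (ofFunctor Φ F).toUntr.map a) := Category.assoc _ _ _
        _ = (ofFunctor Φ F).toUntr.map cb ≫ (ofFunctor Φ F).toUntr.map p' :=
            congrArg (fun t => (ofFunctor Φ F).toUntr.map cb ≫ t) hψ₁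
        _ = (ofFunctor Φ F).toUntr.map a := hQa
    · change Base (untrFunctor hF) ((ofFunctor Φ F).toUntr.map cb ≫ ψ) = Base (untrFunctor hF) (𝟙 _)
      rw [base_comp, hψ₂, base_id]
      exact eb.hom_inv_id
  exact ⟨P, p', ⟨(ofFunctor Φ F).toUntr.map cb, ψ, h₂, h₁⟩, hp, hQa.symm⟩

/-- **Def. 1.3 (iv)(b) for `C^un-tr`**: every pull-back morphism of `C^un-tr` is LB-invertible and
linear (it is an isomorphism followed by the class of a pull-back morphism of `C`, which is isometric
and linear; every arrow of `C^un-tr` is co-angular). [cite: MochizukiFrdI2008, Def. 1.3 (iv) p.24] -/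
theorem isLBInvertible_isLinear_of_isPullback_untr (hF : IsFrobenioid F) {Y B : (ofFunctor Φ F).Untr}
    (α : Y ⟶ B) (hα : IsPullbackMorphism (untrFunctor hF) α) :
    IsLBInvertible (untrFunctor hF) α ∧ IsLinear (untrFunctor hF) α := by
  obtain ⟨P, p, e, hp, rfl⟩ := exists_iso_comp_toUntr_of_isPullbackMorphism hF α hα
  have hp' := hF.iv_b p.hom hp
  have hiso : Div (untrFunctor hF) e.hom = 1 :=
    isIsometry_of_isIso (untrFunctor hF) (isPreFrobenioid_untr hF) e.hom
  refine ⟨⟨isCoAngular_untr hF _, ?_⟩, ?_⟩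
  · change Div (untrFunctor hF) (e.hom ≫ (ofFunctor Φ F).toUntr.map p) = 1
    rw [div_comp, hiso, one_pow, mul_one]
    have hd : Div F p.hom = 1 := hp'.1.2
    exact (congrArg (pull Φ (Base (untrFunctor hF) e.hom)) hd).trans (map_one _)
  · change degFr (untrFunctor hF) (e.hom ≫ (ofFunctor Φ F).toUntr.map p) = 1
    rw [degFr_comp, show degFr (untrFunctor hF) e.hom = 1 from isLinear_of_isIso (untrFunctor hF) e.hom,
      one_mul]
    exact hp'.2

/-! ### Def. 1.3 (iv)(a), uniqueness, for `C^un-tr` -/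

/-- **Def. 1.3 (iv)(a), uniqueness of the factorisation, for `C^un-tr`**: two factorisations
(Frobenius type) ≫ (pre-step) ≫ (pull-back) of the same arrow of `C^un-tr` differ by unique
isomorphisms — the Frobenius-type parts have the same degree (pull-backs and pre-steps being linear),
hence differ by an isomorphism `ε` (Def. 1.3 (ii)); cancelling the epimorphism `γ`, the universal
properties of the two pull-back morphisms produce the isomorphism `δ` and the compatibilities.
[cite: MochizukiFrdI2008, Def. 1.3 (iv) p.24] -/
theorem factorisation_unique_untr (hF : IsFrobenioid F) ⦃A B X Y X' Y' : (ofFunctor Φ F).Untr⦄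
    (φ : A ⟶ B) (γ : A ⟶ X) (β : X ⟶ Y) (α : Y ⟶ B) (γ' : A ⟶ X') (β' : X' ⟶ Y') (α' : Y' ⟶ B)
    (h : γ ≫ β ≫ α = φ) (hγ : IsFrobeniusType (untrFunctor hF) γ) (hβ : IsPreStep (untrFunctor hF) β)
    (hα : IsPullbackMorphism (untrFunctor hF) α) (h' : γ' ≫ β' ≫ α' = φ)
    (hγ' : IsFrobeniusType (untrFunctor hF) γ') (hβ' : IsPreStep (untrFunctor hF) β')
    (hα' : IsPullbackMorphism (untrFunctor hF) α') :
    ∃ (ε : X ≅ X') (δ : Y ≅ Y'), γ ≫ ε.hom = γ' ∧ β ≫ δ.hom = ε.hom ≫ β' ∧ α = δ.hom ≫ α' := by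
  have hαl : IsLinear (untrFunctor hF) α := (isLBInvertible_isLinear_of_isPullback_untr hF α hα).2
  have hα'l : IsLinear (untrFunctor hF) α' := (isLBInvertible_isLinear_of_isPullback_untr hF α' hα').2
  -- degrees of the Frobenius-type parts agree
  have hdeg : degFr (untrFunctor hF) γ = degFr (untrFunctor hF) γ' := by
    have e₁ : degFr (untrFunctor hF) φ = degFr (untrFunctor hF) γ := by
      rw [← h, degFr_comp, degFr_comp, show degFr (untrFunctor hF) β = 1 from hβ.1, hαl, mul_one, mul_one]
    have e₂ : degFr (untrFunctor hF) φ = degFr (untrFunctor hF) γ' := by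
      rw [← h', degFr_comp, degFr_comp, show degFr (untrFunctor hF) β' = 1 from hβ'.1, hα'l, mul_one,
        mul_one]
    rw [← e₁, e₂]
  obtain ⟨ε, hε⟩ := exists_iso_of_isFrobeniusType_untr hF γ γ' hγ hγ' hdeg
  -- cancel `γ`
  haveI := (isTotallyEpimorphic_untr hF).epi γ
  have hrest : β ≫ α = ε.hom ≫ β' ≫ α' := by
    rw [← cancel_epi γ, h, ← h', ← hε, Category.assoc]
  haveI : IsIso (Base (untrFunctor hF) β) := hβ.2
  haveI : IsIso (Base (untrFunctor hF) β') := hβ'.2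
  -- the base arrow of the comparison `δ`
  let b : baseObj (untrFunctor hF) Y ⟶ baseObj (untrFunctor hF) Y' :=
    inv (Base (untrFunctor hF) β) ≫ Base (untrFunctor hF) ε.hom ≫ Base (untrFunctor hF) β'
  haveI : IsIso (Base (untrFunctor hF) ε.hom) := isBaseIso_of_isIso (untrFunctor hF) ε.hom
  haveI : IsIso b := by dsimp only [b]; infer_instance
  have hbase : Base (untrFunctor hF) β ≫ Base (untrFunctor hF) α =
      Base (untrFunctor hF) ε.hom ≫ Base (untrFunctor hF) β' ≫ Base (untrFunctor hF) α' := by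
    rw [← base_comp, hrest, base_comp, base_comp]
  have hb : Base (untrFunctor hF) α = b ≫ Base (untrFunctor hF) α' := by
    dsimp only [b]
    rw [Category.assoc, Category.assoc, ← hbase, IsIso.inv_hom_id_assoc]
  have hb' : Base (untrFunctor hF) α' = inv b ≫ Base (untrFunctor hF) α := by
    rw [hb, IsIso.inv_hom_id_assoc]
  obtain ⟨δ, hδ⟩ := (hα' Y).2 ⟨(α, b), hb⟩
  obtain ⟨δ', hδ'⟩ := (hα Y').2 ⟨(α', inv b), hb'⟩
  have hδ₁ : δ ≫ α' = α := congrArg (fun q : PullbackHomData (untrFunctor hF) α' Y => q.1.1) hδ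
  have hδ₂ : Base (untrFunctor hF) δ = b := congrArg (fun q : PullbackHomData (untrFunctor hF) α' Y => q.1.2) hδ
  have hδ'₁ : δ' ≫ α = α' := congrArg (fun q : PullbackHomData (untrFunctor hF) α Y' => q.1.1) hδ'
  have hδ'₂ : Base (untrFunctor hF) δ' = inv b :=
    congrArg (fun q : PullbackHomData (untrFunctor hF) α Y' => q.1.2) hδ'
  -- `δ ≫ δ' = 𝟙` and `δ' ≫ δ = 𝟙` by uniqueness of lifts
  have h₁ : δ ≫ δ' = 𝟙 Y := by
    apply (hα Y).1
    apply Subtype.ext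
    apply Prod.ext
    · change (δ ≫ δ') ≫ α = 𝟙 Y ≫ α
      rw [Category.assoc, hδ'₁, hδ₁, Category.id_comp]
    · change Base (untrFunctor hF) (δ ≫ δ') = Base (untrFunctor hF) (𝟙 Y)
      rw [base_comp, hδ₂, hδ'₂, IsIso.hom_inv_id, base_id]
  have h₂ : δ' ≫ δ = 𝟙 Y' := by
    apply (hα' Y').1
    apply Subtype.ext
    apply Prod.ext
    · change (δ' ≫ δ) ≫ α' = 𝟙 Y' ≫ α'
      rw [Category.assoc, hδ₁, hδ'₁, Category.id_comp]
    · change Base (untrFunctor hF) (δ' ≫ δ) = Base (untrFunctor hF) (𝟙 Y')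
      rw [base_comp, hδ₂, hδ'₂, IsIso.inv_hom_id, base_id]
  refine ⟨ε, ⟨δ, δ', h₁, h₂⟩, hε, ?_, hδ₁.symm⟩
  -- `β ≫ δ = ε ≫ β'`: both lift `(β ≫ α, Base (ε ≫ β'))` along the pull-back `α'`
  apply (hα' X).1
  apply Subtype.ext
  apply Prod.ext
  · change (β ≫ δ) ≫ α' = (ε.hom ≫ β') ≫ α'
    rw [Category.assoc, hδ₁, hrest, Category.assoc]
  · change Base (untrFunctor hF) (β ≫ δ) = Base (untrFunctor hF) (ε.hom ≫ β')
    rw [base_comp, base_comp, hδ₂]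
    dsimp only [b]
    rw [IsIso.hom_inv_id_assoc]

end PreFrobenioid

end Literature.AlgebraicGeometry.Frobenioids
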